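import Literature.MathematicalPhysics.QuantumFieldTheory.Balaban1983to89.B15TreeGauge196Annulus
import Literature.MathematicalPhysics.QuantumFieldTheory.Balaban1983to89.B16Ineq382Stokes

/-!
# `Balaban1983to89.B16Ineq382Cases` — T. Bałaban, *Large field renormalization. II. Localization, exponentiation, and bounds for the 𝐑 operation*, Commun. Math. Phys. **122** (1989) 355–392 [Balaban1989LargeFieldII], pp. 381–382, case 1 of the factor `1 − χ′`: the hypotheses of *"|V₁(b) − 1| < 6(100MR_{j−N+1})²ε"* on a rectangular annulus of `ℤ^d` in the gauge of [Balaban1989LargeFieldI] p. 196 (`Case1Hyp`), and the cases of the proof in which the loop `Γ_{y,b₋} ∪ b ∪ Γ_{y,b₊}⁻¹` is a thin strip, plus the flat-rectangle bound (PART 2a of the case-1 estimate; PART 2b = `B16Ineq382TreeGauge` finishes)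

statement-level skeleton of published theorems with citation tags; proofs where landed; nothing here is a claim about the Yang–Mills mass gap

PDF held: `paper:balaban1989-cmp122-large-field-ii` (journal page = PDF page + 354; pp. 381–382 = PDF pp. 27–28,
re-read AS IMAGES: `run/shared/lean/pub/pub-balaban/b2b-balaban-ref1/pages/1989-cmp122-large-field-II/…-p027-x2.png`,
`…-p028-x2.png`); `paper:balaban1989-cmp122-large-field-i` (pp. 177, 195–196 = PDF pp. 3, 21–22: condition (i) and
the gauge); [14] = [Balaban1985RegularSpaces] Lemma 1 p. 79 (tree: `B8Lemma1NonAbelian`).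

WHAT IS REPRODUCED (mega-formalization `lit-balaban`, HOME `run/shared/lean/pub/lit-balaban/`, Phase-2 seat p26,
generation 2; SKELETON row **B16.Lem@381** (r13; typed p240851 as the arithmetic shape `B16Sect1Statements.Ineq382V₁`
with the deviation `dev` abstract), referee ref-5).  P. 381–382 (render re-read): *"In the first case we assume that
b ⊂ Ω″^{~2}_{h+1}∖Ω″_{h+1}, so it is a bond belonging to the last domain P₁∖P₂, in which the axial gauge was fixed, the
gauge defined in Sect. 1 [IV] before the definition (1.82) [IV]. … Assume that the plaquette variables of V″ on this
domain are small, i.e., |V″(∂p′) − 1| < ε for p′ ⊂ Ω″^{~2}_{h+1}∖Ω″_{h+1}, and transform the field V″ into a field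
satisfying the axial gauge conditions. … By elementary reasoning, the same as in the proof of Lemma 1 [14], we obtain
the estimate |V₁(b) − 1| < 6(100MR_{j−N+1})²ε …, where we have taken into account that Ω″ᶜ_{h+1} satisfies the
condition (i)"* ([IV] p. 177, (i): "it is contained in a cube of the size 100MR_k").  TYPED: `Case1Hyp lo hi lo' hi' τ
W V ε` — the annulus `P₁ ∖ P₂` (`B15TreeGauge196.ann`, geometry `Geom`), sides of `P₁` of at most `W + 1` sites, `V` a
`U1 𝔸`-valued bond field with `ε`-small plaquettes on `P₁ ∖ P₂` (`B16Ineq382Stokes.PlaqSmallOn`) IN THE GAUGE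
(`V(Γ_{y,x}) = 1`, `x ∈ P₁∖P₂`).  PROVED (the "elementary reasoning", case by case on the bond `b = ⟨x, x + e_μ⟩` and
the kinds of the two contours, via the pair decompositions of `B15TreeGauge196`): `case_usual` (both contours usual:
a ladder along the lower coordinates, `≤ (d−1)Wε`), `case_detour_i1`, `case_detour_high` (both detour: `≤ Wε`,
`≤ dWε`), `case_detour_i0` (a tree bond: `V(b) = 1`), and the flat-rectangle Stokes bound `flat_bound` (`≤ W²ε`) with
the list identity `loop_eq_wideLadder` for the one bond crossing the threshold (its two sub-cases are PART 2b).

HONEST SCOPE.  As PART 2b (`B16Ineq382TreeGauge`): one rectangular annulus of `ℤ^{n+3}` with `P₂` strictly inside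
`P₁`, `U1 𝔸`-valued fields, `≤`-hypotheses; every declaration is a definition with a body or a proved theorem; nothing
of [IV]/[V] is asserted.  Unit `lit-balaban-p26` (literature-prover-lit-balaban-p26-g2-0).
-/

noncomputable section

open scoped BigOperators

namespace Literature.MathematicalPhysics.QuantumFieldTheory.Balaban1983to89.B16Ineq382

open B7Prop1Explicit B8Lemma1NonAbelian B15TreeGauge196

variable {n : ℕ} {𝔸 : Type*} [NormedRing 𝔸] [NormOneClass 𝔸]

/-! ## §1 The hypotheses of case 1 (p. 381) -/

/-- **The situation of p. 381, case 1**, on the annulus `P₁ ∖ P₂ = ann lo hi lo' hi'` of `ℤ^{n+3}`: the geometry of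
[IV] p. 196 (`Geom`), sides of `P₁` of at most `W + 1` sites (condition (i) of [IV] p. 177: "contained in a cube of
the size 100MR_k"), a `U1`-valued bond field `V` (= the printed `V₁ = V″^v`) with `|V(∂p′) − 1| ≤ ε` for the
plaquettes `p′` with corners in `P₁∖P₂`, satisfying the axial gauge conditions `V(Γ_{y,x}) = 1`, `x ∈ P₁∖P₂`.
[cite: Balaban1989LargeFieldII, p.381] -/
structure Case1Hyp (lo hi lo' hi' : Site (n + 3)) (τ : ℤ) (W : ℕ) (V : Site (n + 3) → Fin (n + 3) → 𝔸ˣ)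
    (ε : ℝ) : Prop where
  geom : Geom lo hi lo' hi' τ
  width : ∀ κ, hi κ - lo κ ≤ W
  unit : ∀ x κ, V x κ ∈ U1 𝔸
  eps_nonneg : 0 ≤ ε
  plaq : PlaqSmallOn (ann lo hi lo' hi') V ε
  gauge : ∀ x ∈ ann lo hi lo' hi', hol V lo (contour lo hi τ x) = 1

variable {lo hi lo' hi' : Site (n + 3)} {τ : ℤ} {W : ℕ} {V : Site (n + 3) → Fin (n + 3) → 𝔸ˣ} {ε : ℝ}

/-- Coordinates of `x − y` for `x ∈ P₁` are between `0` and `W`. [cite: Balaban1989LargeFieldI, p.177] -/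
theorem Case1Hyp.natAbs_le (H : Case1Hyp lo hi lo' hi' τ W V ε) {x : Site (n + 3)} (hx : x ∈ box lo hi)
    (κ : Fin (n + 3)) : ((x - lo) κ).natAbs ≤ W := by
  have h1 := (mem_box_iff.mp hx κ).1; have h2 := (mem_box_iff.mp hx κ).2; have h3 := H.width κ
  simp only [Pi.sub_apply]; omega

/-! ## §2 The thin-strip cases (both contours of the same kind) -/

/-- **Both contours usual** (`x₁ ≦ a` for both ends): `‖V(b) − 1‖ ≤ (d−1)W·ε` — the ladder along the lower
coordinates of the two contours. [cite: Balaban1989LargeFieldII, p.382] -/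
theorem case_usual (H : Case1Hyp lo hi lo' hi' τ W V ε) {x : Site (n + 3)} {μ : Fin (n + 3)}
    (hx : x ∈ ann lo hi lo' hi') (hx' : x + e μ ∈ ann lo hi lo' hi') (hxτ : x i0 ≤ τ)
    (hxτ' : (x + e μ : Site (n + 3)) i0 ≤ τ) :
    ‖((V x μ : 𝔸ˣ) : 𝔸) - 1‖ ≤ (n + 2) * W * ε := by
  obtain ⟨K₁, K₂, hK⟩ := List.append_of_mem (List.mem_reverse.mpr (List.mem_finRange μ))
  have hxb := mem_box_iff.mp hx.1
  have hv : 0 ≤ (x - lo) μ := by simpa using (hxb μ).1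
  obtain ⟨hc, hc'⟩ := contour_pair_usual (hi := hi) hK hxτ hxτ' hv
  set c := tw K₁ (x - lo) ++ seg μ ((x - lo) μ)
  set u := tw K₂ (x - lo)
  have hnd := (finRange_reverse_nodup (n := n))
  rw [hK] at hnd
  have hμK₂ : μ ∉ K₂ := (List.nodup_cons.mp (List.nodup_append.mp hnd).2.1).1
  have hu : ∀ l ∈ u, l.1 ≠ μ := fun l hl h => hμK₂ (h ▸ fst_mem_of_mem_tw hl)
  have hp := contour_pathIn H.geom hx
  rw [hc, pathIn_append] at hp
  have hp' := contour_pathIn H.geom hx'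
  rw [hc', pathIn_append, pathIn_cons, Letter.vec_true] at hp'
  have hg := H.gauge x hx
  rw [hc, hol_append] at hg
  have hg' := H.gauge _ hx'
  rw [hc', hol_append, hol_cons, stepHol_true, Letter.vec_true] at hg'
  have hxq : lo + disp c + disp u = x := by
    have h1 := disp_contour (lo := lo) (hi := hi) (τ := τ) (x := x)
    rw [hc, disp_append] at h1
    rw [add_assoc, h1, add_sub_cancel]
  have hb := norm_bond_sub_one_le_of_ladder H.unit H.plaq (hol_mem H.unit lo c) hu hp.2 hp'.2.2 hg hg'
  rw [hxq] at hb
  refine hb.trans (mul_le_mul_of_nonneg_right ?_ H.eps_nonneg)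
  have hlen : u.length ≤ (n + 2) * W := by
    refine (length_tw_le fun κ _ => H.natAbs_le hx.1 κ).trans (Nat.mul_le_mul_right _ ?_)
    have := congrArg List.length hK
    simp only [List.length_reverse, List.length_finRange, List.length_append, List.length_cons] at this
    omega
  exact_mod_cast hlen

/-- **Both contours detour, `b` in direction `2`**: the ladder along the way back in direction `1`,
`‖V(b) − 1‖ ≤ W·ε`. [cite: Balaban1989LargeFieldII, p.382] -/
theorem case_detour_i1 (H : Case1Hyp lo hi lo' hi' τ W V ε) {x : Site (n + 3)}
    (hx : x ∈ ann lo hi lo' hi') (hx' : x + e i1 ∈ ann lo hi lo' hi') (hxτ : ¬ x i0 ≤ τ) :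
    ‖((V x i1 : 𝔸ˣ) : 𝔸) - 1‖ ≤ W * ε := by
  have hxb := mem_box_iff.mp hx.1
  have hv : 0 ≤ (x - lo) i1 := by simpa using (hxb i1).1
  obtain ⟨hc, hc'⟩ := contour_pair_detour_i1 (hi := hi) hxτ hv
  set c := tw (highDirs n) (x - lo) ++ seg i0 (hi i0 - lo i0) ++ seg i1 (x i1 - lo i1)
  set u := seg i0 (x i0 - hi i0)
  have hu : ∀ l ∈ u, l.1 ≠ i1 := fun l hl => by rw [mem_seg hl]; exact i1_ne_i0.symm
  have hp := contour_pathIn H.geom hx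
  rw [hc, pathIn_append] at hp
  have hp' := contour_pathIn H.geom hx'
  rw [hc', pathIn_append, pathIn_cons, Letter.vec_true] at hp'
  have hg := H.gauge x hx
  rw [hc, hol_append] at hg
  have hg' := H.gauge _ hx'
  rw [hc', hol_append, hol_cons, stepHol_true, Letter.vec_true] at hg'
  have hxq : lo + disp c + disp u = x := by
    have h1 := disp_contour (lo := lo) (hi := hi) (τ := τ) (x := x)
    rw [hc, disp_append] at h1
    rw [add_assoc, h1, add_sub_cancel]
  have hb := norm_bond_sub_one_le_of_ladder H.unit H.plaq (hol_mem H.unit lo c) hu hp.2 hp'.2.2 hg hg'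
  rw [hxq] at hb
  refine hb.trans (mul_le_mul_of_nonneg_right ?_ H.eps_nonneg)
  have hlen : u.length ≤ W := by
    have h1 := (hxb i0).1; have h2 := (hxb i0).2; have h3 := H.width i0
    simp only [u, length_seg]; omega
  exact_mod_cast hlen

/-- The detour pieces have `≤ 3W` bonds. [cite: Balaban1989LargeFieldII, p.382] -/
theorem Case1Hyp.length_detourTail_le (H : Case1Hyp lo hi lo' hi' τ W V ε) {x : Site (n + 3)}
    (hx : x ∈ box lo hi) : (detourTail lo hi x).length ≤ 3 * W := by
  have hxb := mem_box_iff.mp hx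
  have h1 := (hxb i0).1; have h2 := (hxb i0).2; have h3 := H.width i0
  have h4 := (hxb i1).1; have h5 := (hxb i1).2; have h6 := H.width i1
  simp only [detourTail, List.length_append, length_seg]; omega

/-- **Both contours detour, `b` in a direction `≥ 3`**: the ladder along the lower high coordinates and the three
detour pieces, `‖V(b) − 1‖ ≤ dW·ε`. [cite: Balaban1989LargeFieldII, p.382] -/
theorem case_detour_high (H : Case1Hyp lo hi lo' hi' τ W V ε) {x : Site (n + 3)} {μ : Fin (n + 3)}
    (hμ : 2 ≤ μ.val) (hx : x ∈ ann lo hi lo' hi') (hx' : x + e μ ∈ ann lo hi lo' hi') (hxτ : ¬ x i0 ≤ τ) :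
    ‖((V x μ : 𝔸ˣ) : 𝔸) - 1‖ ≤ (n + 3) * W * ε := by
  obtain ⟨H₁, H₂, hH⟩ := List.append_of_mem (mem_highDirs.mpr hμ)
  have hxb := mem_box_iff.mp hx.1
  have hv : 0 ≤ (x - lo) μ := by simpa using (hxb μ).1
  obtain ⟨hc, hc'⟩ := contour_pair_detour_high (hi := hi) (τ := τ) hH hxτ hv
  set c := tw H₁ (x - lo) ++ seg μ ((x - lo) μ)
  set u := tw H₂ (x - lo) ++ detourTail lo hi x
  have hnd := (highDirs_nodup (n := n))
  rw [hH] at hnd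
  have hμH₂ : μ ∉ H₂ := (List.nodup_cons.mp (List.nodup_append.mp hnd).2.1).1
  have hμ0 : i0 ≠ μ := fun h => by rw [← h, i0_val] at hμ; omega
  have hμ1 : i1 ≠ μ := fun h => by rw [← h, i1_val] at hμ; omega
  have hu : ∀ l ∈ u, l.1 ≠ μ := by
    intro l hl h
    simp only [u, detourTail, List.mem_append] at hl
    rcases hl with hl | ((hl | hl) | hl)
    · exact hμH₂ (h ▸ fst_mem_of_mem_tw hl)
    · exact hμ0 (by rw [← h, mem_seg hl])
    · exact hμ1 (by rw [← h, mem_seg hl])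
    · exact hμ0 (by rw [← h, mem_seg hl])
  have hp := contour_pathIn H.geom hx
  rw [hc, pathIn_append] at hp
  have hp' := contour_pathIn H.geom hx'
  rw [hc', pathIn_append, pathIn_cons, Letter.vec_true] at hp'
  have hg := H.gauge x hx
  rw [hc, hol_append] at hg
  have hg' := H.gauge _ hx'
  rw [hc', hol_append, hol_cons, stepHol_true, Letter.vec_true] at hg'
  have hxq : lo + disp c + disp u = x := by
    have h1 := disp_contour (lo := lo) (hi := hi) (τ := τ) (x := x)
    rw [hc, disp_append] at h1
    rw [add_assoc, h1, add_sub_cancel]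
  have hb := norm_bond_sub_one_le_of_ladder H.unit H.plaq (hol_mem H.unit lo c) hu hp.2 hp'.2.2 hg hg'
  rw [hxq] at hb
  refine hb.trans (mul_le_mul_of_nonneg_right ?_ H.eps_nonneg)
  have hlen : u.length ≤ (n + 3) * W := by
    have h1 : (tw H₂ (x - lo)).length ≤ n * W := by
      refine (length_tw_le fun κ _ => H.natAbs_le hx.1 κ).trans (Nat.mul_le_mul_right _ ?_)
      have := congrArg List.length hH
      simp only [length_highDirs, List.length_append, List.length_cons] at this
      omega
    have h2 := H.length_detourTail_le hx.1
    simp only [u, List.length_append]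
    nlinarith
  exact_mod_cast hlen

/-- **Both contours detour, `b` in direction `1`**: `b` is the last bond of `Γ_{y,x}` — a tree bond, `V(b) = 1`.
[cite: Balaban1989LargeFieldII, p.382] -/
theorem case_detour_i0 (H : Case1Hyp lo hi lo' hi' τ W V ε) {x : Site (n + 3)}
    (hx : x ∈ ann lo hi lo' hi') (hx' : x + e i0 ∈ ann lo hi lo' hi') (hxτ : ¬ x i0 ≤ τ) : V x i0 = 1 := by
  have hle : x i0 + 1 ≤ hi i0 := by simpa [e_apply_self] using (mem_box_iff.mp hx'.1 i0).2
  have hg := H.gauge x hx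
  rw [contour_pair_detour_i0 hxτ hle, hol_append, H.gauge _ hx', one_mul, hol_cons, hol_nil, mul_one,
    stepHol_false, disp_contour, show lo + (x + e i0 - lo) - e i0 = x by abel, inv_eq_one] at hg
  exact hg

/-! ## §3 The bond across the threshold: rectangle, flat or moved off `P₂` -/

/-- The loop of the mixed pair is a rectangle boundary: `[2-seg m] ∪ [1-seg n₀] ∪ b ∪ ([1-seg N] ∪ [2-seg m] ∪
[1-seg −k])⁻¹ = wideLadder ([2-seg m]) 1 N` for `N = n₀ + k + 1` (list algebra). [cite: Balaban1989LargeFieldII, p.382] -/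
theorem loop_eq_wideLadder {d : ℕ} (κ ν : Fin d) (m n₀ k : ℕ) :
    (seg ν (m : ℤ) ++ seg κ (n₀ : ℤ)) ++ (κ, true) ::
        revWord (seg κ ((n₀ + (k + 1) : ℕ) : ℤ) ++ seg ν (m : ℤ) ++ seg κ (-(k : ℤ))) =
      wideLadder (seg ν (m : ℤ)) κ (n₀ + (k + 1)) := by
  have hs : seg κ ((n₀ + (k + 1) : ℕ) : ℤ) = seg κ (n₀ : ℤ) ++ (κ, true) :: seg κ (k : ℤ) := by
    rw [seg_natCast, seg_natCast, seg_natCast, List.replicate_add, List.replicate_succ]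
  rw [wideLadder, revWord_append, revWord_append, revWord_seg, revWord_seg, revWord_seg, neg_neg, hs]
  simp [List.append_assoc]

/-- `pt` does not see a move in a high direction. [cite: Balaban1989LargeFieldI, p.196] -/
theorem pt_add_e_high (a b j : ℤ) (x : Site (n + 3)) {κ : Fin (n + 3)} (hκ : 2 ≤ κ.val) :
    pt a b x + j • e κ = pt a b (x + j • e κ) := by
  funext κ'
  simp only [Pi.add_apply, zsmul_e_apply, pt]
  split_ifs <;> first | rfl | omega

/-- **Flat rectangle**: the boundary of the rectangle `(y₁, y₂, ỹ) + [0,N]e₁ + [0,m]e₂` inside `P₁`, all of whose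
sites avoid `P₂`, deviates by `≤ N·m·ε ≤ W²ε`. [cite: Balaban1989LargeFieldII, p.382] -/
theorem flat_bound (H : Case1Hyp lo hi lo' hi' τ W V ε) {y : Site (n + 3)} {m N : ℕ}
    (hm : lo i1 + m ≤ hi i1) (hN : lo i0 + N ≤ hi i0)
    (hy : ∀ κ : Fin (n + 3), 2 ≤ κ.val → lo κ ≤ y κ ∧ y κ ≤ hi κ)
    (hesc : ∀ s t : ℕ, s ≤ N → t ≤ m → pt (lo i0 + s) (lo i1 + t) y ∉ box lo' hi') (hmW : m ≤ W) (hNW : N ≤ W) :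
    ‖((hol V (pt (lo i0) (lo i1) y) (wideLadder (seg i1 (m : ℤ)) i0 N) : 𝔸ˣ) : 𝔸) - 1‖ ≤ (W : ℝ) ^ 2 * ε := by
  have h := norm_hol_wideLadder_sub_one_le H.unit H.plaq i0 (seg i1 (m : ℤ))
    (fun l hl => by rw [mem_seg hl]; exact i1_ne_i0) N (pt (lo i0) (lo i1) y) fun j hj => by
    rw [pt_add_e0, pathIn_seg_natCast]
    intro t ht
    rw [pt_add_e1]
    exact ⟨pt_mem_box_iff.mpr ⟨⟨by omega, by omega⟩, ⟨by omega, by omega⟩, hy⟩, hesc j t hj ht⟩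
  refine h.trans ?_
  rw [length_seg, Int.natAbs_natCast]
  have h1 : (N : ℝ) * ((m : ℝ) * ε) ≤ W * (W * ε) :=
    mul_le_mul (by exact_mod_cast hNW) (mul_le_mul_of_nonneg_right (by exact_mod_cast hmW) H.eps_nonneg)
      (by have := H.eps_nonneg; positivity) (by positivity)
  nlinarith [h1]

end Literature.MathematicalPhysics.QuantumFieldTheory.Balaban1983to89.B16Ineq382
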